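import Summits.QuantumAdvantage.QuantumAdvantage.Theses.TwoSquaresLadder

/-!
# Route `TwoSquaresLadder`, support `BlumFaceGivesTarget` (stmt-QuantumAdvantage-16067)

If the promise problem "anti-Blum semiprimes `pq`, `p ≡ q ≡ 1 (4)`" versus "Blum integers `pq`,
`p ≡ q ≡ 3 (4)`" is not in (strong) promise-`BPP`, then the language of sums of two squares is not in `BPP`:
`S₂` itself separates the two sides — `pq` with `p ≡ q ≡ 1 (4)` is a sum of two squares and `pq` with
`p ≠ q`, `p ≡ q ≡ 3 (4)` is not (Fermat–Euler: every prime `≡ 3 (4)` must occur to an even power; Mathlib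
`Nat.eq_sq_add_sq_iff`). The tree's `PromiseBPP = promiseLift BPP` is "separated by a `BPP` language".

HONEST FRAMING: a closed ledger item (elementary, kernel-checked), NOT summit progress.

References: Fermat–Euler two-squares theorem (Mathlib `Nat.eq_sq_add_sq_iff`); O. Goldreich, *On promise problems*
(2006), §1.2 [Goldreich2006]; J. van de Graaf, R. Peralta, CRYPTO '87 (doi:10.1007/3-540-48184-2_9).
-/

set_option linter.dupNamespace false -- D-0017: single-problem summit ⇒ `QuantumAdvantage.QuantumAdvantage` by design

namespace Summit.QuantumAdvantage.QuantumAdvantage.Theorems.BlumFaceGivesTarget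

open _root_.Computability Literature.Computability.Complexity

/-- An anti-Blum semiprime `pq`, `p ≡ q ≡ 1 (mod 4)`, is a sum of two squares (no prime factor is `≡ 3 (4)`).
[Fermat–Euler] [folklore] -/
theorem antiBlum_mem {p q : ℕ} (hp : p.Prime) (hq : q.Prime) (hp1 : p % 4 = 1) (hq1 : q % 4 = 1) :
    ∃ a b : ℕ, p * q = a ^ 2 + b ^ 2 := by
  rw [Nat.eq_sq_add_sq_iff]
  intro r hr hr3
  rw [Nat.primeFactors_mul hp.ne_zero hq.ne_zero, Finset.mem_union, hp.primeFactors, hq.primeFactors,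
    Finset.mem_singleton, Finset.mem_singleton] at hr
  rcases hr with rfl | rfl <;> omega

/-- A Blum integer `pq`, `p ≠ q`, `p ≡ q ≡ 3 (mod 4)`, is not a sum of two squares (`p` occurs to the first power).
[Fermat–Euler] [folklore] -/
theorem blum_not_mem {p q : ℕ} (hp : p.Prime) (hq : q.Prime) (hpq : p ≠ q) (hp3 : p % 4 = 3) :
    ¬ ∃ a b : ℕ, p * q = a ^ 2 + b ^ 2 := by
  rw [Nat.eq_sq_add_sq_iff]
  intro h
  haveI := Fact.mk hp
  haveI := Fact.mk hq
  have hmem : p ∈ (p * q).primeFactors := by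
    rw [Nat.primeFactors_mul hp.ne_zero hq.ne_zero, Finset.mem_union, hp.primeFactors, Finset.mem_singleton]
    exact Or.inl rfl
  have hv : padicValNat p (p * q) = 1 := by
    rw [padicValNat.mul hp.ne_zero hq.ne_zero, padicValNat_self, padicValNat_primes hpq]
  have := h p hmem hp3
  rw [hv] at this
  exact Nat.not_even_one this

/-- **`BlumFaceGivesTarget`** (stmt-QuantumAdvantage-16067): if recognising Blum integers among products of two
primes in the same residue class mod `4` is not in (strong) promise-`BPP`, then `S₂ ∉ BPP` — `S₂` is a separating
language. [Goldreich 2006, §1.2; Fermat–Euler] -/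
theorem blumFaceGivesTarget_proof :
    Summit.QuantumAdvantage.QuantumAdvantage.Theses.TwoSquaresLadder.BlumFaceGivesTarget := by
  unfold Summit.QuantumAdvantage.QuantumAdvantage.Theses.TwoSquaresLadder.BlumFaceGivesTarget
    Summit.QuantumAdvantage.QuantumAdvantage.Theses.TwoSquaresLadder.TwoSquaresNotBPP
  intro hBlum hS2
  apply hBlum
  rw [PromiseBPP, mem_promiseLift_iff]
  refine ⟨_, hS2, ?_, ?_⟩
  · -- yes-instances are sums of two squares
    rintro x ⟨N, hN, rfl⟩
    obtain ⟨p, q, hp, hq, -, hp1, hq1, rfl⟩ := hN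
    exact ⟨p * q, antiBlum_mem hp hq hp1 hq1, rfl⟩
  · -- no-instances are not
    rintro x ⟨N, hN, rfl⟩ ⟨M, hM, hMN⟩
    obtain ⟨p, q, hp, hq, hpq, hp3, -, rfl⟩ := hN
    have hdec : M = p * q := by
      have := congrArg decodeNat hMN
      simpa [encodingNatBool] using this
    subst hdec
    exact blum_not_mem hp hq hpq hp3 hM

end Summit.QuantumAdvantage.QuantumAdvantage.Theorems.BlumFaceGivesTarget
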